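import Mathlib
import Summits.NavierStokesRegularity.NavierStokesRegularity.Theorems.EulerZoomLiouvillePowerGaugeEulerLiouvilleCondenserThinWindowGap
import Summits.NavierStokesRegularity.NavierStokesRegularity.Theorems.EulerZoomLiouvillePowerGaugeEulerLiouvilleCondenserWindowSummation

/-!
# THEOREM K^Σ′ AT PROFILE LEVEL — `curl V ≡ 0` from a divergent window family (nsreg-p2 g37 ROUND-47 v1.3 §5b; the profile-level cut
# of `Condenser.selfSimilar_ae_eq_zero_of_windowDivergentC2_of` asked for the past-exact twin t50-KΣ′-PAST, key 01:14:10Z (e))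

Width piece for crux `EulerZoomLiouville.PowerGaugeEulerLiouville` (stmt-NavierStokesRegularity-19832), by name under LEAD 19832
(ns-typeII-p2 g14); seat ns-sfl-p1 g7 (K∞/K^Σ assembler), `--supports stmt-NavierStokesRegularity-19832 --as helper`.

`curl_eq_zero_of_windowDivergent` — PROFILE LEVEL, no member data: a `C²` self-similar Euler profile `(V, P′)` with centre `0` and rate
`γ = 1/(2+ρ)` (`0 < ρ ≤ ½`) obeying the ball amplitude budget `∫_{B(0,r)}‖V‖² ≤ C_A r^{1−2ρ}` (`r > 0`) and the GLOBAL weighted energy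
budget `∫⁻ ‖DV‖ₑ²‖y‖^{ρ−1} ≤ E`, whose gradient has envelopes `‖DV‖ ≤ exp(G_k)` on `B(0,qℓ_k)` (`G_k ≥ 1`) along pairwise disjoint windows
`[ℓ_k, qℓ_k)` (`q > 1`, `qℓ_k ≤ ℓ_{k+1}`) with `Σ_k ℓ_k^{2+ρ}/G_k = ∞`, is IRROTATIONAL.  Proof = the `hcurl` block of
`…CondenserWindowSummability` (K″'s per-window step with `θ = ½`: cut-off copy `Loc.exists_cutoff_local`, exit or `curl_eq_zero_of_noexit`,
(B″_g) `shellCondenserGaugeForm`; tail windows; ns-ezl-w2 g5's (W4′) `weightedWindowBudget_of` + (W4) `windowSummation_of` BY NAME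
(p684678); `summable_nat_add_iff`).  The member theorems (`windowSummabilityLiouville`, `summabilityLiouville`, K∞, T3) are this +
`Loc.selfSimilar_ae_eq_zero_of_irrotationalC2_profile`; the past-exact twin is this + the past budgets + the past irrotational filler.

HONEST FRAMING: a statement about HYPOTHETICAL self-similar Euler profiles with the crux class's budgets (MODEL lattice); nothing here
proves the crux E (19832 OPEN), any door Target, or Navier–Stokes regularity. [nsreg-p2 ROUND-47 v1.3 THEOREM K^Σ′;
cite: ConstantinIgnatovaVicol2026Putative, §3.4.1; folklore (length–area method)]
-/

noncomputable section

open Set Filter Topology Metric Function MeasureTheory Real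
open scoped RealInnerProductSpace NNReal ENNReal

set_option linter.dupNamespace false

namespace Summit.NavierStokesRegularity.NavierStokesRegularity.Theorems.PowerGaugeEulerLiouville.Condenser

open Literature.Analysis Literature.Analysis.FluidPDE
open Summit.NavierStokesRegularity.NavierStokesRegularity.Theorems.PowerGaugeEulerLiouville

/-- **K^Σ′ AT PROFILE LEVEL: a divergent window family forces `curl V ≡ 0`.**  See the module docstring.
[nsreg-p2 ROUND-47 v1.3 THEOREM K^Σ′; cite: ConstantinIgnatovaVicol2026Putative, §3.4.1; folklore (length–area method)] -/
theorem curl_eq_zero_of_windowDivergent {ρ : ℝ} (hρ : 0 < ρ) (hρ1 : ρ ≤ 1 / 2)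
    {V : EuclideanSpace ℝ (Fin 3) → EuclideanSpace ℝ (Fin 3)} {P' : EuclideanSpace ℝ (Fin 3) → ℝ}
    (hprof : IsSelfSimilarEulerProfile (1 / (2 + ρ)) 0 V P') (hV : ContDiff ℝ 2 V)
    {CA : ℝ} (hCApos : 0 < CA)
    (hbA : ∀ r : ℝ, 0 < r → ∫ x in ball (0 : EuclideanSpace ℝ (Fin 3)) r, ‖V x‖ ^ 2 ≤ CA * r ^ (1 - 2 * ρ))
    {E : ℝ} (hE0 : 0 ≤ E) (hE : ∫⁻ y, ‖fderiv ℝ V y‖ₑ ^ 2 * ENNReal.ofReal (‖y‖ ^ (ρ - 1)) ≤ ENNReal.ofReal E)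
    {q : ℝ} {ℓ G : ℕ → ℝ} (hq : 1 < q) (hℓpos : ∀ k : ℕ, 0 < ℓ k) (hsep : ∀ k : ℕ, q * ℓ k ≤ ℓ (k + 1))
    (hG1 : ∀ k : ℕ, 1 ≤ G k)
    (henv : ∀ k : ℕ, ∀ z ∈ ball (0 : EuclideanSpace ℝ (Fin 3)) (q * ℓ k), ‖fderiv ℝ V z‖ ≤ Real.exp (G k))
    (hdiv : ¬ Summable (fun k : ℕ => ℓ k ^ (2 + ρ) / G k)) :
    ∀ x : EuclideanSpace ℝ (Fin 3), curl V x = 0 := by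
  have hπ : 0 < Real.pi := Real.pi_pos
  have hρ1' : ρ < 1 := by linarith
  have h2ρ : (0 : ℝ) < 2 + ρ := by linarith
  have hγ : (0 : ℝ) < 1 / (2 + ρ) := one_div_pos.2 h2ρ
  have hγ2 : 1 / (2 + ρ) < 1 / 2 := one_div_lt_one_div_of_lt two_pos (by linarith)
  have hV1 : ContDiff ℝ 1 V := hV.of_le (by norm_num)
  -- FIXED loss `θ = 1/2`; the windows grow at least geometrically
  obtain ⟨θ, hθdef⟩ : ∃ θ : ℝ, θ = 1 / 2 := ⟨_, rfl⟩
  have hθ0 : 0 < θ := by rw [hθdef]; norm_num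
  have hθ1 : θ < 1 := by rw [hθdef]; norm_num
  have hq0 : 0 < q := by linarith
  have hℓgrow : ∀ k : ℕ, q ^ k * ℓ 0 ≤ ℓ k := by
    intro k
    induction k with
    | zero => simp
    | succ k ih =>
      calc q ^ (k + 1) * ℓ 0 = q * (q ^ k * ℓ 0) := by rw [pow_succ]; ring
        _ ≤ q * ℓ k := mul_le_mul_of_nonneg_left ih hq0.le
        _ ≤ ℓ (k + 1) := hsep k
  have hℓlarge : ∀ M : ℝ, ∃ k₀ : ℕ, ∀ k : ℕ, k₀ ≤ k → M ≤ ℓ k := by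
    intro M
    obtain ⟨k₀, hk₀⟩ := pow_unbounded_of_one_lt (M / ℓ 0) hq
    refine ⟨k₀, fun k hk => ?_⟩
    have h1 : M / ℓ 0 < q ^ k := hk₀.trans_le (pow_le_pow_right₀ hq.le hk)
    have h2 : M < q ^ k * ℓ 0 := by rwa [div_lt_iff₀ (hℓpos 0)] at h1
    exact h2.le.trans (hℓgrow k)
  -- the shell condenser in gauge form at `(γ, ρ, C_A, q, θ)`
  obtain ⟨R₁, hR₁, hBg⟩ := shellCondenserGaugeForm (1 / (2 + ρ)) ρ CA q θ hγ hρ.le hCApos hq hθ0 hθ1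
  -- the window constant `κ` and the Dirichlet counting function `F`
  obtain ⟨κw, hκdef⟩ : ∃ κw : ℝ, κw = θ * (2 * Real.pi * (1 / (2 + ρ)) ^ 2 * (q ^ 3 - 1)) / 3 := ⟨_, rfl⟩
  have hq3 : 0 < q ^ 3 - 1 := by nlinarith [pow_lt_pow_left₀ hq zero_le_one three_ne_zero]
  have hκpos : 0 < κw := by rw [hκdef]; positivity
  set F : ℝ → ℝ := fun t => ∫ z in ball (0 : EuclideanSpace ℝ (Fin 3)) t, ‖fderiv ℝ V z‖ ^ 2 with hF
  have hDVc : Continuous fun z => ‖fderiv ℝ V z‖ ^ 2 := (hV.continuous_fderiv (by norm_num)).norm.pow 2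
  have hFint : ∀ t : ℝ, IntegrableOn (fun z => ‖fderiv ℝ V z‖ ^ 2) (ball (0 : EuclideanSpace ℝ (Fin 3)) t) volume :=
    fun t => (hDVc.continuousOn.integrableOn_compact (isCompact_closedBall 0 t)).mono_set ball_subset_closedBall
  intro x
  by_contra hxc
  -- a tail `k ≥ k₀` of the windows beyond `max(R₁, 1, ‖x‖+1)`
  obtain ⟨k₀, hk₀⟩ := hℓlarge (max (max R₁ 1) (‖x‖ + 1))
  have hℓk : ∀ k : ℕ, R₁ ≤ ℓ (k₀ + k) ∧ 1 ≤ ℓ (k₀ + k) ∧ ‖x‖ + 1 ≤ ℓ (k₀ + k) := by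
    intro k
    have h := hk₀ (k₀ + k) (Nat.le_add_right _ _)
    exact ⟨((le_max_left _ _).trans (le_max_left _ _)).trans h, ((le_max_right _ _).trans (le_max_left _ _)).trans h,
      (le_max_right _ _).trans h⟩
  -- every tail window pays `κ ℓ_k³ / G_k`
  have hwin : ∀ k : ℕ, κw * ℓ (k₀ + k) ^ 3 / G (k₀ + k) ≤ F (q * ℓ (k₀ + k)) - F (ℓ (k₀ + k)) := by
    intro k
    obtain ⟨hR₁ℓ, hℓ1, hxℓ⟩ := hℓk k
    set l : ℝ := ℓ (k₀ + k) with hl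
    have hl0 : 0 < l := hℓpos _
    have hGk : 0 < G (k₀ + k) := zero_lt_one.trans_le (hG1 _)
    have hql : l ≤ q * l := le_mul_of_one_le_left hl0.le hq.le
    -- the shell budget `S = F(ql) − F(l)`
    have hshell : F (q * l) - F l =
        ∫ z in ball (0 : EuclideanSpace ℝ (Fin 3)) (q * l) ∩ {x | l ≤ ‖x‖}, ‖fderiv ℝ V z‖ ^ 2 := by
      rw [← ball_sdiff_ball_eq_shell, setIntegral_sdiff measurableSet_ball (hFint _) (ball_subset_ball hql)]
    have hSl0 : 0 ≤ ∫ z in ball (0 : EuclideanSpace ℝ (Fin 3)) (q * l) ∩ {x | l ≤ ‖x‖}, ‖fderiv ℝ V z‖ ^ 2 :=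
      setIntegral_nonneg (measurableSet_ball.inter (measurableSet_le measurable_const continuous_norm.measurable))
        fun z _ => sq_nonneg _
    by_contra hlt
    push Not at hlt
    rw [hshell] at hlt
    -- a budget `S` strictly between `S_l` and the cost
    have hcost : 0 < κw * l ^ 3 / G (k₀ + k) := by positivity
    obtain ⟨S, hSdef⟩ : ∃ S : ℝ, S =
        ((∫ z in ball (0 : EuclideanSpace ℝ (Fin 3)) (q * l) ∩ {x | l ≤ ‖x‖}, ‖fderiv ℝ V z‖ ^ 2) +
          κw * l ^ 3 / G (k₀ + k)) / 2 := ⟨_, rfl⟩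
    have hS : 0 < S := by rw [hSdef]; linarith
    have hSlS : (∫ z in ball (0 : EuclideanSpace ℝ (Fin 3)) (q * l) ∩ {x | l ≤ ‖x‖}, ‖fderiv ℝ V z‖ ^ 2) ≤ S := by
      rw [hSdef]; linarith
    have hSa : S < κw * l ^ 3 / G (k₀ + k) := by rw [hSdef]; linarith
    -- a `C²` cut-off copy agreeing with `V` on `B(0,(q+1)l)`
    obtain ⟨Vc, hVc2, -, -, ⟨K, hK⟩, hVU⟩ := Loc.exists_cutoff_local hV (R := (q + 1) * l) (by positivity)
    have hVc1 : ContDiff ℝ 1 Vc := hVc2.of_le (by norm_num)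
    have hsub : ball (0 : EuclideanSpace ℝ (Fin 3)) (q * l) ⊆ ball (0 : EuclideanSpace ℝ (Fin 3)) ((q + 1) * l) :=
      ball_subset_ball (by linarith)
    have hfd : ∀ z ∈ ball (0 : EuclideanSpace ℝ (Fin 3)) ((q + 1) * l), fderiv ℝ Vc z = fderiv ℝ V z := fun z hz =>
      Filter.EventuallyEq.fderiv_eq (Filter.eventually_of_mem (isOpen_ball.mem_nhds hz) hVU)
    -- an exit from `B(0,l)` through `‖·‖ = ql` must exist, else `curl V x = 0`
    have hex : ∃ (y : EuclideanSpace ℝ (Fin 3)) (L : ℝ), ‖y‖ < l ∧ 0 ≤ L ∧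
        q * l ≤ ‖ODE.evolutionMap (fun _ : ℝ => selfSimilarTransport (1 / (2 + ρ)) 0 Vc) 0 (-L) y‖ := by
      by_contra hne
      push Not at hne
      exact hxc (curl_eq_zero_of_noexit hprof hγ hγ2 hV hVc1 hK hl0 hq hVU
        (fun y hy L hL => hne y L hy hL) (by linarith))
    obtain ⟨y, L, hy, hL, hexit⟩ := hex
    -- budgets of the cut-off copy
    have hAc : ∫ z in ball (0 : EuclideanSpace ℝ (Fin 3)) (q * l), ‖Vc z‖ ^ 2 ≤ CA * (q * l) ^ (1 - 2 * ρ) := by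
      rw [setIntegral_congr_fun measurableSet_ball (fun z hz => by rw [hVU z (hsub hz)])]
      exact hbA _ (by positivity)
    have hEc : ∫ z in ball (0 : EuclideanSpace ℝ (Fin 3)) (q * l) ∩ {x : EuclideanSpace ℝ (Fin 3) | l ≤ ‖x‖},
        ‖fderiv ℝ Vc z‖ ^ 2 ≤ S := by
      rw [setIntegral_congr_fun
        (measurableSet_ball.inter (measurableSet_le measurable_const continuous_norm.measurable))
        (fun z hz => by rw [hfd z (hsub hz.1)])]
      exact hSlS
    -- (B″_g) … under the envelope `exp(G_k)` on `B(0,ql)`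
    obtain ⟨z, hz, hzle⟩ := hBg Vc K hVc1 hK l S hR₁ℓ hS hAc hEc y L hL hy hexit
    rw [hfd z (hsub hz)] at hzle
    have hineq := Real.exp_le_exp.1 (hzle.trans (henv (k₀ + k) z hz))
    -- `κ l³ / G_k ≤ S`, contradicting `S < κ l³/G_k`
    have hfin : κw * l ^ 3 / G (k₀ + k) ≤ S := by
      rw [div_le_iff₀ hGk]
      have h1 : θ * (2 * Real.pi * (1 / (2 + ρ)) ^ 2 * (q ^ 3 - 1) * l ^ 3 / (3 * S)) * (3 * S) ≤ G (k₀ + k) * (3 * S) :=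
        mul_le_mul_of_nonneg_right hineq (by positivity)
      have e1 : θ * (2 * Real.pi * (1 / (2 + ρ)) ^ 2 * (q ^ 3 - 1) * l ^ 3 / (3 * S)) * (3 * S) = 3 * (κw * l ^ 3) := by
        rw [hκdef]; field_simp
      rw [e1] at h1
      nlinarith [h1]
    linarith
  -- (W4′)+(W4) on the tail family: the divergent series would be summable
  have hℓpos' : ∀ k : ℕ, 0 < ℓ (k₀ + k) := fun k => hℓpos _
  have hsep' : ∀ k : ℕ, q * ℓ (k₀ + k) ≤ ℓ (k₀ + (k + 1)) := fun k => by rw [← add_assoc]; exact hsep _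
  have hGpos' : ∀ k : ℕ, 0 < G (k₀ + k) := fun k => zero_lt_one.trans_le (hG1 _)
  have hsum : ∀ n : ℕ, ∑ k ∈ Finset.range n,
      (q * ℓ (k₀ + k)) ^ (ρ - 1) * (F (q * ℓ (k₀ + k)) - F (ℓ (k₀ + k))) ≤ E :=
    fun n => weightedWindowBudget_of (ℓ := fun k => ℓ (k₀ + k)) hV1 hρ1' hq hℓpos' hsep' hE0 hE n
  have hsumm : Summable (fun k : ℕ => ℓ (k₀ + k) ^ (2 + ρ) / G (k₀ + k)) :=
    windowSummation_of (F := F) (ρ := ρ) (ℓ := fun k => ℓ (k₀ + k)) (G := fun k => G (k₀ + k)) hq hκpos hℓpos' hGpos' hsum hwin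
  have hsumm' : Summable (fun k : ℕ => ℓ k ^ (2 + ρ) / G k) := by
    rw [← summable_nat_add_iff k₀]
    refine hsumm.congr fun k => ?_
    rw [add_comm]
  exact hdiv hsumm'

/-- **K^Σ′ AT PROFILE LEVEL, amplitude budget at radii `≥ 1` only** (the shape delivered by the PAST budgets
`NeedleRace.needleBudgets_of_selfSimilarC2_past`; asked by ns-ezl-w2 g5 for t50-KΣ′-PAST, 01:19:02Z): as
`curl_eq_zero_of_windowDivergent`, with `hbA` assumed for `1 ≤ r` only (the loop uses it at `r = qℓ_k ≥ 1`).
[nsreg-p2 ROUND-47 v1.3 THEOREM K^Σ′; cite: ConstantinIgnatovaVicol2026Putative, §3.4.1; folklore (length–area method)] -/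
theorem curl_eq_zero_of_windowDivergent_of_ge_one {ρ : ℝ} (hρ : 0 < ρ) (hρ1 : ρ ≤ 1 / 2)
    {V : EuclideanSpace ℝ (Fin 3) → EuclideanSpace ℝ (Fin 3)} {P' : EuclideanSpace ℝ (Fin 3) → ℝ}
    (hprof : IsSelfSimilarEulerProfile (1 / (2 + ρ)) 0 V P') (hV : ContDiff ℝ 2 V)
    {CA : ℝ} (hCApos : 0 < CA)
    (hbA : ∀ r : ℝ, 1 ≤ r → ∫ x in ball (0 : EuclideanSpace ℝ (Fin 3)) r, ‖V x‖ ^ 2 ≤ CA * r ^ (1 - 2 * ρ))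
    {E : ℝ} (hE0 : 0 ≤ E) (hE : ∫⁻ y, ‖fderiv ℝ V y‖ₑ ^ 2 * ENNReal.ofReal (‖y‖ ^ (ρ - 1)) ≤ ENNReal.ofReal E)
    {q : ℝ} {ℓ G : ℕ → ℝ} (hq : 1 < q) (hℓpos : ∀ k : ℕ, 0 < ℓ k) (hsep : ∀ k : ℕ, q * ℓ k ≤ ℓ (k + 1))
    (hG1 : ∀ k : ℕ, 1 ≤ G k)
    (henv : ∀ k : ℕ, ∀ z ∈ ball (0 : EuclideanSpace ℝ (Fin 3)) (q * ℓ k), ‖fderiv ℝ V z‖ ≤ Real.exp (G k))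
    (hdiv : ¬ Summable (fun k : ℕ => ℓ k ^ (2 + ρ) / G k)) :
    ∀ x : EuclideanSpace ℝ (Fin 3), curl V x = 0 := by
  have hπ : 0 < Real.pi := Real.pi_pos
  have hρ1' : ρ < 1 := by linarith
  have h2ρ : (0 : ℝ) < 2 + ρ := by linarith
  have hγ : (0 : ℝ) < 1 / (2 + ρ) := one_div_pos.2 h2ρ
  have hγ2 : 1 / (2 + ρ) < 1 / 2 := one_div_lt_one_div_of_lt two_pos (by linarith)
  have hV1 : ContDiff ℝ 1 V := hV.of_le (by norm_num)
  -- FIXED loss `θ = 1/2`; the windows grow at least geometrically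
  obtain ⟨θ, hθdef⟩ : ∃ θ : ℝ, θ = 1 / 2 := ⟨_, rfl⟩
  have hθ0 : 0 < θ := by rw [hθdef]; norm_num
  have hθ1 : θ < 1 := by rw [hθdef]; norm_num
  have hq0 : 0 < q := by linarith
  have hℓgrow : ∀ k : ℕ, q ^ k * ℓ 0 ≤ ℓ k := by
    intro k
    induction k with
    | zero => simp
    | succ k ih =>
      calc q ^ (k + 1) * ℓ 0 = q * (q ^ k * ℓ 0) := by rw [pow_succ]; ring
        _ ≤ q * ℓ k := mul_le_mul_of_nonneg_left ih hq0.le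
        _ ≤ ℓ (k + 1) := hsep k
  have hℓlarge : ∀ M : ℝ, ∃ k₀ : ℕ, ∀ k : ℕ, k₀ ≤ k → M ≤ ℓ k := by
    intro M
    obtain ⟨k₀, hk₀⟩ := pow_unbounded_of_one_lt (M / ℓ 0) hq
    refine ⟨k₀, fun k hk => ?_⟩
    have h1 : M / ℓ 0 < q ^ k := hk₀.trans_le (pow_le_pow_right₀ hq.le hk)
    have h2 : M < q ^ k * ℓ 0 := by rwa [div_lt_iff₀ (hℓpos 0)] at h1
    exact h2.le.trans (hℓgrow k)
  -- the shell condenser in gauge form at `(γ, ρ, C_A, q, θ)`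
  obtain ⟨R₁, hR₁, hBg⟩ := shellCondenserGaugeForm (1 / (2 + ρ)) ρ CA q θ hγ hρ.le hCApos hq hθ0 hθ1
  -- the window constant `κ` and the Dirichlet counting function `F`
  obtain ⟨κw, hκdef⟩ : ∃ κw : ℝ, κw = θ * (2 * Real.pi * (1 / (2 + ρ)) ^ 2 * (q ^ 3 - 1)) / 3 := ⟨_, rfl⟩
  have hq3 : 0 < q ^ 3 - 1 := by nlinarith [pow_lt_pow_left₀ hq zero_le_one three_ne_zero]
  have hκpos : 0 < κw := by rw [hκdef]; positivity
  set F : ℝ → ℝ := fun t => ∫ z in ball (0 : EuclideanSpace ℝ (Fin 3)) t, ‖fderiv ℝ V z‖ ^ 2 with hF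
  have hDVc : Continuous fun z => ‖fderiv ℝ V z‖ ^ 2 := (hV.continuous_fderiv (by norm_num)).norm.pow 2
  have hFint : ∀ t : ℝ, IntegrableOn (fun z => ‖fderiv ℝ V z‖ ^ 2) (ball (0 : EuclideanSpace ℝ (Fin 3)) t) volume :=
    fun t => (hDVc.continuousOn.integrableOn_compact (isCompact_closedBall 0 t)).mono_set ball_subset_closedBall
  intro x
  by_contra hxc
  -- a tail `k ≥ k₀` of the windows beyond `max(R₁, 1, ‖x‖+1)`
  obtain ⟨k₀, hk₀⟩ := hℓlarge (max (max R₁ 1) (‖x‖ + 1))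
  have hℓk : ∀ k : ℕ, R₁ ≤ ℓ (k₀ + k) ∧ 1 ≤ ℓ (k₀ + k) ∧ ‖x‖ + 1 ≤ ℓ (k₀ + k) := by
    intro k
    have h := hk₀ (k₀ + k) (Nat.le_add_right _ _)
    exact ⟨((le_max_left _ _).trans (le_max_left _ _)).trans h, ((le_max_right _ _).trans (le_max_left _ _)).trans h,
      (le_max_right _ _).trans h⟩
  -- every tail window pays `κ ℓ_k³ / G_k`
  have hwin : ∀ k : ℕ, κw * ℓ (k₀ + k) ^ 3 / G (k₀ + k) ≤ F (q * ℓ (k₀ + k)) - F (ℓ (k₀ + k)) := by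
    intro k
    obtain ⟨hR₁ℓ, hℓ1, hxℓ⟩ := hℓk k
    set l : ℝ := ℓ (k₀ + k) with hl
    have hl0 : 0 < l := hℓpos _
    have hGk : 0 < G (k₀ + k) := zero_lt_one.trans_le (hG1 _)
    have hql : l ≤ q * l := le_mul_of_one_le_left hl0.le hq.le
    -- the shell budget `S = F(ql) − F(l)`
    have hshell : F (q * l) - F l =
        ∫ z in ball (0 : EuclideanSpace ℝ (Fin 3)) (q * l) ∩ {x | l ≤ ‖x‖}, ‖fderiv ℝ V z‖ ^ 2 := by
      rw [← ball_sdiff_ball_eq_shell, setIntegral_sdiff measurableSet_ball (hFint _) (ball_subset_ball hql)]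
    have hSl0 : 0 ≤ ∫ z in ball (0 : EuclideanSpace ℝ (Fin 3)) (q * l) ∩ {x | l ≤ ‖x‖}, ‖fderiv ℝ V z‖ ^ 2 :=
      setIntegral_nonneg (measurableSet_ball.inter (measurableSet_le measurable_const continuous_norm.measurable))
        fun z _ => sq_nonneg _
    by_contra hlt
    push Not at hlt
    rw [hshell] at hlt
    -- a budget `S` strictly between `S_l` and the cost
    have hcost : 0 < κw * l ^ 3 / G (k₀ + k) := by positivity
    obtain ⟨S, hSdef⟩ : ∃ S : ℝ, S =
        ((∫ z in ball (0 : EuclideanSpace ℝ (Fin 3)) (q * l) ∩ {x | l ≤ ‖x‖}, ‖fderiv ℝ V z‖ ^ 2) +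
          κw * l ^ 3 / G (k₀ + k)) / 2 := ⟨_, rfl⟩
    have hS : 0 < S := by rw [hSdef]; linarith
    have hSlS : (∫ z in ball (0 : EuclideanSpace ℝ (Fin 3)) (q * l) ∩ {x | l ≤ ‖x‖}, ‖fderiv ℝ V z‖ ^ 2) ≤ S := by
      rw [hSdef]; linarith
    have hSa : S < κw * l ^ 3 / G (k₀ + k) := by rw [hSdef]; linarith
    -- a `C²` cut-off copy agreeing with `V` on `B(0,(q+1)l)`
    obtain ⟨Vc, hVc2, -, -, ⟨K, hK⟩, hVU⟩ := Loc.exists_cutoff_local hV (R := (q + 1) * l) (by positivity)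
    have hVc1 : ContDiff ℝ 1 Vc := hVc2.of_le (by norm_num)
    have hsub : ball (0 : EuclideanSpace ℝ (Fin 3)) (q * l) ⊆ ball (0 : EuclideanSpace ℝ (Fin 3)) ((q + 1) * l) :=
      ball_subset_ball (by linarith)
    have hfd : ∀ z ∈ ball (0 : EuclideanSpace ℝ (Fin 3)) ((q + 1) * l), fderiv ℝ Vc z = fderiv ℝ V z := fun z hz =>
      Filter.EventuallyEq.fderiv_eq (Filter.eventually_of_mem (isOpen_ball.mem_nhds hz) hVU)
    -- an exit from `B(0,l)` through `‖·‖ = ql` must exist, else `curl V x = 0`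
    have hex : ∃ (y : EuclideanSpace ℝ (Fin 3)) (L : ℝ), ‖y‖ < l ∧ 0 ≤ L ∧
        q * l ≤ ‖ODE.evolutionMap (fun _ : ℝ => selfSimilarTransport (1 / (2 + ρ)) 0 Vc) 0 (-L) y‖ := by
      by_contra hne
      push Not at hne
      exact hxc (curl_eq_zero_of_noexit hprof hγ hγ2 hV hVc1 hK hl0 hq hVU
        (fun y hy L hL => hne y L hy hL) (by linarith))
    obtain ⟨y, L, hy, hL, hexit⟩ := hex
    -- budgets of the cut-off copy
    have hAc : ∫ z in ball (0 : EuclideanSpace ℝ (Fin 3)) (q * l), ‖Vc z‖ ^ 2 ≤ CA * (q * l) ^ (1 - 2 * ρ) := by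
      rw [setIntegral_congr_fun measurableSet_ball (fun z hz => by rw [hVU z (hsub hz)])]
      exact hbA _ (hℓ1.trans hql)
    have hEc : ∫ z in ball (0 : EuclideanSpace ℝ (Fin 3)) (q * l) ∩ {x : EuclideanSpace ℝ (Fin 3) | l ≤ ‖x‖},
        ‖fderiv ℝ Vc z‖ ^ 2 ≤ S := by
      rw [setIntegral_congr_fun
        (measurableSet_ball.inter (measurableSet_le measurable_const continuous_norm.measurable))
        (fun z hz => by rw [hfd z (hsub hz.1)])]
      exact hSlS
    -- (B″_g) … under the envelope `exp(G_k)` on `B(0,ql)`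
    obtain ⟨z, hz, hzle⟩ := hBg Vc K hVc1 hK l S hR₁ℓ hS hAc hEc y L hL hy hexit
    rw [hfd z (hsub hz)] at hzle
    have hineq := Real.exp_le_exp.1 (hzle.trans (henv (k₀ + k) z hz))
    -- `κ l³ / G_k ≤ S`, contradicting `S < κ l³/G_k`
    have hfin : κw * l ^ 3 / G (k₀ + k) ≤ S := by
      rw [div_le_iff₀ hGk]
      have h1 : θ * (2 * Real.pi * (1 / (2 + ρ)) ^ 2 * (q ^ 3 - 1) * l ^ 3 / (3 * S)) * (3 * S) ≤ G (k₀ + k) * (3 * S) :=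
        mul_le_mul_of_nonneg_right hineq (by positivity)
      have e1 : θ * (2 * Real.pi * (1 / (2 + ρ)) ^ 2 * (q ^ 3 - 1) * l ^ 3 / (3 * S)) * (3 * S) = 3 * (κw * l ^ 3) := by
        rw [hκdef]; field_simp
      rw [e1] at h1
      nlinarith [h1]
    linarith
  -- (W4′)+(W4) on the tail family: the divergent series would be summable
  have hℓpos' : ∀ k : ℕ, 0 < ℓ (k₀ + k) := fun k => hℓpos _
  have hsep' : ∀ k : ℕ, q * ℓ (k₀ + k) ≤ ℓ (k₀ + (k + 1)) := fun k => by rw [← add_assoc]; exact hsep _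
  have hGpos' : ∀ k : ℕ, 0 < G (k₀ + k) := fun k => zero_lt_one.trans_le (hG1 _)
  have hsum : ∀ n : ℕ, ∑ k ∈ Finset.range n,
      (q * ℓ (k₀ + k)) ^ (ρ - 1) * (F (q * ℓ (k₀ + k)) - F (ℓ (k₀ + k))) ≤ E :=
    fun n => weightedWindowBudget_of (ℓ := fun k => ℓ (k₀ + k)) hV1 hρ1' hq hℓpos' hsep' hE0 hE n
  have hsumm : Summable (fun k : ℕ => ℓ (k₀ + k) ^ (2 + ρ) / G (k₀ + k)) :=
    windowSummation_of (F := F) (ρ := ρ) (ℓ := fun k => ℓ (k₀ + k)) (G := fun k => G (k₀ + k)) hq hκpos hℓpos' hGpos' hsum hwin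
  have hsumm' : Summable (fun k : ℕ => ℓ k ^ (2 + ρ) / G k) := by
    rw [← summable_nat_add_iff k₀]
    refine hsumm.congr fun k => ?_
    rw [add_comm]
  exact hdiv hsumm'

end Summit.NavierStokesRegularity.NavierStokesRegularity.Theorems.PowerGaugeEulerLiouville.Condenser

end
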